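import Summits.RiemannHypothesis.RiemannHypothesis.Theorems.OddSectorOddOneSignedWindowsLayerDefs
import Summits.RiemannHypothesis.RiemannHypothesis.Theorems.WeilGroundStateMarkovPartPositiveGroundStateDensityAux
import Summits.RiemannHypothesis.RiemannHypothesis.Theorems.WeilWindowFlowWindowLipschitzStubSupBoundAux
import Literature.NumberTheory.LFunctions.WeilGroundStateRealZerosProofs
import HarnessLib

/-!
# RiemannHypothesis / GroundBarta — rung 4 (`EvenWinsBeyondArch`, stmt-RiemannHypothesis-18807):
# the deflated Temple (Lehmann–Maehly) L-side programme, Ia — polarised increments and energies on the window form domain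

Helper file (`--supports stmt-RiemannHypothesis-18807`), RH-free, Mathlib + landed tree files only, no
definitions, no named facts.

The RH-free residue of rung 4 is the parity ladder of certified window cells (`ε_ev < ε_od` cell by cell,
item stmt-RiemannHypothesis-18085 / 18807); its L-sides (certified LOWER bounds for the sector bottoms
`ε_od(c) = weilOddGroundEnergy c`, `ε_ev(c) = weilEvenGroundEnergy c`) are so far Yoshida moment certificates,
whose T-tail undercount is a precision wall at `c ≈ 0.75` (FEASIBILITY-234 on 18085/18807).  The way round it
is the DEFLATED TEMPLE / LEHMANN–MAEHLY INCLUSION (abstract lemma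
`Literature.Analysis.OperatorTheory.deflatedFormBound_of_decomp`, p179129): explicit Ritz data `v₁ … v_k`
with window residuals, plus a LOW-precision certificate `β` on a finite-codimension complement, give
`ε_sector(c) ≥ λ`.  Its instantiation on the windowed Weil form needs the CLOSED form
`E(f, h) = P(f, h) + 𝓔_c(f, h) − M_c⟨f, h⟩` (`weilPoleForm₂`, `weilDirichletEnergy₂` of
`Theorems/OddSectorOddOneSignedWindowsLayerDefs`, Bombieri's Markov decomposition polarised) as a genuine
symmetric BILINEAR form on the finite-energy window class
`D_c = {f ∈ L² : f = 0 off [-c, c], ∫₀^∞ ρ(t) D_t(f) dt < ∞}`.  This file is that bookkeeping: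

* increments: `D_t(f + h) = D_t(f) + D_t(h) + 2 D_t(f, h)`, `D_t(a • f) = a² D_t(f)`, symmetry / additivity /
  real homogeneity of `D_t(f, h) = weilIncrement₂ f h t`, `|D_t(f, h)| ≤ (D_t(f) + D_t(h))/2`, measurability in
  `t`, integrability of `ρ(t) D_t(f, h)` on `(0, ∞)` for finite-energy `f, h`;
* energies: the same for `𝓔_c(f, h) = weilDirichletEnergy₂ c f h`, and closure of the finite-energy class
  under `+` and real scalars;
* (the pole form, the real pairing and the closed form itself are in the sibling
  `Theorems/GroundBartaEvenWinsBeyondArchDeflationForms.lean`).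

(The integrability lemmas are adapted from the private toolkit of
`Theorems/OddSectorOddOneSignedWindowsOddEulerLagrange.lean`.)  Prover B, speedrun unit `sr-gb-rung-b` (gen 3).

References: E. Bombieri, Rend. Mat. Acc. Lincei (9) 11 (2000) 183–233, Thm 2 and §4; A. Weinstein,
W. Stenger, *Methods of Intermediate Problems for Eigenvalues* (1972) Ch. 5 §9; M. Fukushima, Y. Oshima,
M. Takeda, *Dirichlet Forms and Symmetric Markov Processes* (2011) §1.1.
-/

set_option linter.dupNamespace false

noncomputable section

open MeasureTheory Set Filter
open scoped Topology ENNReal NNReal ComplexConjugate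

namespace Summit.RiemannHypothesis.RiemannHypothesis.Theorems.EvenWinsBeyondArch

open Literature.NumberTheory.LFunctions Literature.NumberTheory.LFunctions.ConnesVanSuijlekom
open Summit.RiemannHypothesis.RiemannHypothesis.Theorems.OddSector
  (weilIncrement₂ weilDirichletEnergy₂ weilPoleForm₂ weilIncrement₂_self weilDirichletEnergy₂_self
    weilPoleForm₂_self re_mul_conj_self)
open Summit.RiemannHypothesis.RiemannHypothesis.Theorems.WeilGroundStateMarkovPart (weilIncrement_add_le)
open Summit.RiemannHypothesis.RiemannHypothesis.Theorems.WeilWindowFlowWindowLipschitz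
  (stub_supBound_aesm_shear stub_supBound_aesm_weilIncrement)

variable {f g h f₁ f₂ : ℝ → ℂ} {c : ℝ}

/-! ## Pointwise algebra -/

/-- `|Re(z w̄)| ≤ (‖z‖² + ‖w‖²)/2`. -/
theorem dt_abs_re_mul_conj_le (z w : ℂ) : |(z * conj w).re| ≤ (‖z‖ ^ 2 + ‖w‖ ^ 2) / 2 := by
  refine (Complex.abs_re_le_norm _).trans ?_
  rw [norm_mul, Complex.norm_conj]
  linarith [two_mul_le_add_sq ‖z‖ ‖w‖]

/-- `‖z + w‖² = ‖z‖² + ‖w‖² + 2 Re(z w̄)`. -/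
theorem dt_norm_add_sq (z w : ℂ) : ‖z + w‖ ^ 2 = ‖z‖ ^ 2 + ‖w‖ ^ 2 + 2 * (z * conj w).re := by
  rw [← Complex.normSq_eq_norm_sq, ← Complex.normSq_eq_norm_sq, ← Complex.normSq_eq_norm_sq,
    Complex.normSq_add]

/-- Pointwise value of a real multiple of a complex-valued function. -/
theorem dt_smul_apply (a : ℝ) (f : ℝ → ℂ) (x : ℝ) : (a • f) x = (a : ℂ) * f x := by
  simp only [Pi.smul_apply, Complex.real_smul]

/-! ## Measurability and integrability of increment fields -/

/-- `t ↦ D_t(v, w) = weilIncrement₂ v w t` is a.e.-strongly measurable (Fubini measurability of a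
parametric integral; the shear `(t, x) ↦ x + t` is quasi-measure-preserving,
`WeilWindowFlowWindowLipschitz.stub_supBound_aesm_shear`). -/
theorem dt_aesm_weilIncrement₂ {v w : ℝ → ℂ} (hv : AEStronglyMeasurable v volume)
    (hw : AEStronglyMeasurable w volume) :
    AEStronglyMeasurable (weilIncrement₂ v w) volume := by
  have h : AEStronglyMeasurable (fun p : ℝ × ℝ ↦
      ((v (p.2 + p.1) - v p.2) * conj (w (p.2 + p.1) - w p.2)).re) (volume.prod volume) :=
    Complex.continuous_re.comp_aestronglyMeasurable
      (((stub_supBound_aesm_shear hv).sub hv.comp_snd).mul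
        (Complex.continuous_conj.comp_aestronglyMeasurable
          ((stub_supBound_aesm_shear hw).sub hw.comp_snd)))
  exact h.integral_prod_right'

/-- The difference of a translate and the function is in `L²`. -/
theorem dt_memLp_field {v : ℝ → ℂ} (hv : MemLp v 2) (t : ℝ) :
    MemLp (fun x ↦ v (x + t) - v x) 2 :=
  (hv.comp_measurePreserving (measurePreserving_add_right volume t)).sub hv

/-- The polarised increment integrand is integrable for `L²` data. -/
theorem dt_integrable_field_mul {v w : ℝ → ℂ} (hv : MemLp v 2) (hw : MemLp w 2) (t : ℝ) :
    Integrable fun x ↦ (v (x + t) - v x) * conj (w (x + t) - w x) :=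
  (dt_memLp_field hv t).integrable_mul (memLp_conj (dt_memLp_field hw t))

/-- Its real part is integrable. -/
theorem dt_integrable_field_mul_re {v w : ℝ → ℂ} (hv : MemLp v 2) (hw : MemLp w 2) (t : ℝ) :
    Integrable fun x ↦ ((v (x + t) - v x) * conj (w (x + t) - w x)).re := by
  simpa only [RCLike.re_to_complex] using (dt_integrable_field_mul hv hw t).re

/-- An `L²` function vanishing off `[-a, a]` is integrable against every continuous weight. -/
theorem dt_integrable_mul_continuous {v : ℝ → ℂ} {a : ℝ} (hv : MemLp v 2)
    (hv0 : ∀ x, x ∉ Icc (-a) a → v x = 0) {φ : ℝ → ℂ} (hφ : Continuous φ) :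
    Integrable fun x ↦ v x * φ x :=
  (IntegrableOn.mul_continuousOn ((hv.restrict (Icc (-a) a)).integrable one_le_two)
    hφ.continuousOn isCompact_Icc).integrable_of_ae_notMem_eq_zero
      (Eventually.of_forall fun x hxs ↦ by simp [hv0 x hxs])

/-- Products of `L²` functions are integrable (real part). -/
theorem dt_integrable_mul_conj_re (hf : MemLp f 2) (hh : MemLp h 2) :
    Integrable fun x ↦ (f x * conj (h x)).re := by
  have h1 : Integrable fun x ↦ f x * conj (h x) := hf.integrable_mul (memLp_conj hh)
  simpa only [RCLike.re_to_complex] using h1.re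

/-! ## The polarised increment `D_t(f, h)` -/

/-- Symmetry: `D_t(f, h) = D_t(h, f)`. -/
theorem dt_weilIncrement₂_comm (f h : ℝ → ℂ) (t : ℝ) : weilIncrement₂ f h t = weilIncrement₂ h f t := by
  unfold weilIncrement₂
  congr 1 with x
  simp only [Complex.mul_re, Complex.conj_re, Complex.conj_im]
  ring

/-- Additivity in the first slot (for `L²` data). -/
theorem dt_weilIncrement₂_add_left (hf₁ : MemLp f₁ 2) (hf₂ : MemLp f₂ 2) (hh : MemLp h 2) (t : ℝ) :
    weilIncrement₂ (f₁ + f₂) h t = weilIncrement₂ f₁ h t + weilIncrement₂ f₂ h t := by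
  unfold weilIncrement₂
  rw [← integral_add (dt_integrable_field_mul_re hf₁ hh t) (dt_integrable_field_mul_re hf₂ hh t)]
  congr 1 with x
  simp only [Pi.add_apply]
  rw [show f₁ (x + t) + f₂ (x + t) - (f₁ x + f₂ x) = (f₁ (x + t) - f₁ x) + (f₂ (x + t) - f₂ x) by ring,
    add_mul, Complex.add_re]

/-- Real homogeneity in the first slot. -/
theorem dt_weilIncrement₂_smul_left (a : ℝ) (f h : ℝ → ℂ) (t : ℝ) :
    weilIncrement₂ (a • f) h t = a * weilIncrement₂ f h t := by
  unfold weilIncrement₂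
  rw [← integral_const_mul]
  congr 1 with x
  rw [dt_smul_apply, dt_smul_apply,
    show ((a : ℂ) * f (x + t) - (a : ℂ) * f x) * conj (h (x + t) - h x) =
      (a : ℂ) * ((f (x + t) - f x) * conj (h (x + t) - h x)) by ring, Complex.re_ofReal_mul]

/-- **Polarisation of the increment form**: `D_t(f + h) = D_t(f) + D_t(h) + 2 D_t(f, h)`. -/
theorem dt_weilIncrement_add (hf : MemLp f 2) (hh : MemLp h 2) (t : ℝ) :
    weilIncrement (f + h) t = weilIncrement f t + weilIncrement h t + 2 * weilIncrement₂ f h t := by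
  have hif := integrable_weilIncrement_integrand hf t
  have hih := integrable_weilIncrement_integrand hh t
  have hir := dt_integrable_field_mul_re hf hh t
  have hsum : Integrable fun x ↦ ‖f (x + t) - f x‖ ^ 2 + ‖h (x + t) - h x‖ ^ 2 := hif.add hih
  have h2 : Integrable fun x ↦ 2 * ((f (x + t) - f x) * conj (h (x + t) - h x)).re := hir.const_mul 2
  unfold weilIncrement weilIncrement₂
  have e : ∀ x, ‖(f + h) (x + t) - (f + h) x‖ ^ 2 =
      (‖f (x + t) - f x‖ ^ 2 + ‖h (x + t) - h x‖ ^ 2) +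
        2 * ((f (x + t) - f x) * conj (h (x + t) - h x)).re := by
    intro x
    simp only [Pi.add_apply]
    rw [show f (x + t) + h (x + t) - (f x + h x) = (f (x + t) - f x) + (h (x + t) - h x) by ring,
      dt_norm_add_sq]
  simp_rw [e]
  rw [integral_add hsum h2, integral_add hif hih, integral_const_mul]

/-- `D_t(a • f) = a² D_t(f)` for real `a`. -/
theorem dt_weilIncrement_smul (a : ℝ) (f : ℝ → ℂ) (t : ℝ) :
    weilIncrement (a • f) t = a ^ 2 * weilIncrement f t := by
  unfold weilIncrement
  rw [← integral_const_mul]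
  congr 1 with x
  rw [dt_smul_apply, dt_smul_apply,
    show ((a : ℂ) * f (x + t) - (a : ℂ) * f x) = (a : ℂ) * (f (x + t) - f x) by ring, norm_mul,
    Complex.norm_real, Real.norm_eq_abs, mul_pow, sq_abs]

/-- **AM–GM for the polarised increment**: `|D_t(f, h)| ≤ (D_t(f) + D_t(h))/2`. -/
theorem dt_abs_weilIncrement₂_le (hf : MemLp f 2) (hh : MemLp h 2) (t : ℝ) :
    |weilIncrement₂ f h t| ≤ (weilIncrement f t + weilIncrement h t) / 2 := by
  have hif := integrable_weilIncrement_integrand hf t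
  have hih := integrable_weilIncrement_integrand hh t
  unfold weilIncrement₂ weilIncrement
  rw [← Real.norm_eq_abs]
  calc ‖∫ x, ((f (x + t) - f x) * conj (h (x + t) - h x)).re‖
      ≤ ∫ x, (‖f (x + t) - f x‖ ^ 2 + ‖h (x + t) - h x‖ ^ 2) / 2 :=
        norm_integral_le_of_norm_le ((hif.add hih).div_const 2)
          (Eventually.of_forall fun x ↦ by
            rw [Real.norm_eq_abs]; exact dt_abs_re_mul_conj_le _ _)
    _ = ((∫ x, ‖f (x + t) - f x‖ ^ 2) + ∫ x, ‖h (x + t) - h x‖ ^ 2) / 2 := by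
        rw [integral_div, integral_add hif hih]

/-- **The polarised archimedean energy converges**: `t ↦ ρ(t) D_t(f, h)` is integrable on `(0, ∞)`
when `f, h ∈ L²` have finite archimedean energy. -/
theorem dt_integrableOn_weilIncrement₂ (hf : MemLp f 2) (hh : MemLp h 2)
    (hEf : IntegrableOn (fun t ↦ weilArchDensity t * weilIncrement f t) (Ioi 0))
    (hEh : IntegrableOn (fun t ↦ weilArchDensity t * weilIncrement h t) (Ioi 0)) :
    IntegrableOn (fun t ↦ weilArchDensity t * weilIncrement₂ f h t) (Ioi 0) := by
  have hm : AEStronglyMeasurable (fun t ↦ weilArchDensity t * weilIncrement₂ f h t)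
      (volume.restrict (Ioi 0)) :=
    (measurable_weilArchDensity.aestronglyMeasurable.mul (dt_aesm_weilIncrement₂ hf.1 hh.1)).restrict
  refine Integrable.mono' ((hEf.add hEh).div_const 2) hm ?_
  refine (ae_restrict_iff' measurableSet_Ioi).2 (Eventually.of_forall fun t (ht : 0 < t) ↦ ?_)
  rw [norm_mul, Real.norm_of_nonneg (weilArchDensity_pos ht).le, Real.norm_eq_abs]
  have := mul_le_mul_of_nonneg_left (dt_abs_weilIncrement₂_le hf hh t) (weilArchDensity_pos ht).le
  simp only [Pi.add_apply]
  linarith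

/-! ## The finite-energy class is a real vector space -/

/-- **Closure under addition**: if `f, h ∈ L²` have finite archimedean energy, so does `f + h`
(`D_t(f + h) ≤ 2 D_t(f) + 2 D_t(h)`). -/
theorem dt_finiteEnergy_add (hf : MemLp f 2) (hh : MemLp h 2)
    (hEf : IntegrableOn (fun t ↦ weilArchDensity t * weilIncrement f t) (Ioi 0))
    (hEh : IntegrableOn (fun t ↦ weilArchDensity t * weilIncrement h t) (Ioi 0)) :
    IntegrableOn (fun t ↦ weilArchDensity t * weilIncrement (f + h) t) (Ioi 0) := by
  have hm : AEStronglyMeasurable (fun t ↦ weilArchDensity t * weilIncrement (f + h) t)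
      (volume.restrict (Ioi 0)) :=
    (measurable_weilArchDensity.aestronglyMeasurable.mul
      (stub_supBound_aesm_weilIncrement (hf.add hh).1)).restrict
  refine Integrable.mono' ((hEf.const_mul 2).add (hEh.const_mul 2)) hm ?_
  refine (ae_restrict_iff' measurableSet_Ioi).2 (Eventually.of_forall fun t (ht : 0 < t) ↦ ?_)
  have hρ := (weilArchDensity_pos ht).le
  rw [Real.norm_of_nonneg (mul_nonneg hρ (weilIncrement_nonneg _ _))]
  have h1 : weilIncrement (f + h) t ≤ 2 * weilIncrement f t + 2 * weilIncrement h t :=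
    weilIncrement_add_le hf hh t
  have h2 := mul_le_mul_of_nonneg_left h1 hρ
  simp only [Pi.add_apply]
  linarith

/-- **Closure under real scalars**: `ρ D(a • f) = a² ρ D(f)` is integrable. -/
theorem dt_finiteEnergy_smul (a : ℝ) (f : ℝ → ℂ)
    (hEf : IntegrableOn (fun t ↦ weilArchDensity t * weilIncrement f t) (Ioi 0)) :
    IntegrableOn (fun t ↦ weilArchDensity t * weilIncrement (a • f) t) (Ioi 0) := by
  have e : (fun t ↦ weilArchDensity t * weilIncrement (a • f) t) =
      fun t ↦ a ^ 2 * (weilArchDensity t * weilIncrement f t) := by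
    funext t; rw [dt_weilIncrement_smul]; ring
  rw [e]
  exact hEf.const_mul _

/-- The zero function has finite (zero) energy: `D_t(0) = 0`. -/
theorem dt_weilIncrement_zero (t : ℝ) : weilIncrement (0 : ℝ → ℂ) t = 0 := by
  simp [weilIncrement]

/-- Finite energy of the zero function. -/
theorem dt_finiteEnergy_zero :
    IntegrableOn (fun t ↦ weilArchDensity t * weilIncrement (0 : ℝ → ℂ) t) (Ioi 0) := by
  simp only [dt_weilIncrement_zero, mul_zero]
  exact integrableOn_zero

/-! ## The polarised Dirichlet energy `𝓔_c(f, h)` -/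

/-- Symmetry: `𝓔_c(f, h) = 𝓔_c(h, f)`. -/
theorem dt_weilDirichletEnergy₂_comm (c : ℝ) (f h : ℝ → ℂ) :
    weilDirichletEnergy₂ c f h = weilDirichletEnergy₂ c h f := by
  unfold weilDirichletEnergy₂
  simp only [dt_weilIncrement₂_comm f h]

/-- **Additivity of `𝓔_c(·, h)`** on the finite-energy class. -/
theorem dt_weilDirichletEnergy₂_add_left (c : ℝ) (hf₁ : MemLp f₁ 2) (hf₂ : MemLp f₂ 2) (hh : MemLp h 2)
    (hE₁ : IntegrableOn (fun t ↦ weilArchDensity t * weilIncrement f₁ t) (Ioi 0))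
    (hE₂ : IntegrableOn (fun t ↦ weilArchDensity t * weilIncrement f₂ t) (Ioi 0))
    (hEh : IntegrableOn (fun t ↦ weilArchDensity t * weilIncrement h t) (Ioi 0)) :
    weilDirichletEnergy₂ c (f₁ + f₂) h = weilDirichletEnergy₂ c f₁ h + weilDirichletEnergy₂ c f₂ h := by
  unfold weilDirichletEnergy₂
  have e : ∀ t, weilArchDensity t * weilIncrement₂ (f₁ + f₂) h t =
      weilArchDensity t * weilIncrement₂ f₁ h t + weilArchDensity t * weilIncrement₂ f₂ h t := fun t ↦ by
    rw [dt_weilIncrement₂_add_left hf₁ hf₂ hh]; ring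
  simp_rw [e, dt_weilIncrement₂_add_left hf₁ hf₂ hh, mul_add, Finset.sum_add_distrib]
  rw [integral_add (dt_integrableOn_weilIncrement₂ hf₁ hh hE₁ hEh)
    (dt_integrableOn_weilIncrement₂ hf₂ hh hE₂ hEh)]
  ring

/-- **Real homogeneity of `𝓔_c(·, h)`**. -/
theorem dt_weilDirichletEnergy₂_smul_left (c a : ℝ) (f h : ℝ → ℂ) :
    weilDirichletEnergy₂ c (a • f) h = a * weilDirichletEnergy₂ c f h := by
  unfold weilDirichletEnergy₂
  have e : ∀ t, weilArchDensity t * weilIncrement₂ (a • f) h t =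
      a * (weilArchDensity t * weilIncrement₂ f h t) := fun t ↦ by
    rw [dt_weilIncrement₂_smul_left]; ring
  simp_rw [e, dt_weilIncrement₂_smul_left, integral_const_mul]
  rw [mul_add, Finset.mul_sum]
  congr 1
  exact Finset.sum_congr rfl fun n _ ↦ by ring

/-- **Polarisation of the Dirichlet energy**: `𝓔_c(f + h) = 𝓔_c(f) + 𝓔_c(h) + 2 𝓔_c(f, h)` on the
finite-energy class. -/
theorem dt_weilDirichletEnergy_add (c : ℝ) (hf : MemLp f 2) (hh : MemLp h 2)
    (hEf : IntegrableOn (fun t ↦ weilArchDensity t * weilIncrement f t) (Ioi 0))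
    (hEh : IntegrableOn (fun t ↦ weilArchDensity t * weilIncrement h t) (Ioi 0)) :
    weilDirichletEnergy c (f + h) =
      weilDirichletEnergy c f + weilDirichletEnergy c h + 2 * weilDirichletEnergy₂ c f h := by
  unfold weilDirichletEnergy weilDirichletEnergy₂
  have e : ∀ t, weilArchDensity t * weilIncrement (f + h) t =
      (weilArchDensity t * weilIncrement f t + weilArchDensity t * weilIncrement h t) +
        2 * (weilArchDensity t * weilIncrement₂ f h t) := fun t ↦ by
    rw [dt_weilIncrement_add hf hh]; ring
  have hsum : IntegrableOn (fun t ↦ weilArchDensity t * weilIncrement f t +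
      weilArchDensity t * weilIncrement h t) (Ioi 0) := hEf.add hEh
  have h2 : IntegrableOn (fun t ↦ 2 * (weilArchDensity t * weilIncrement₂ f h t)) (Ioi 0) :=
    (dt_integrableOn_weilIncrement₂ hf hh hEf hEh).const_mul 2
  simp_rw [e, dt_weilIncrement_add hf hh]
  rw [integral_add hsum h2, integral_add hEf hEh, integral_const_mul]
  have es : ∑ n ∈ weilPrimeIndex c, (ArithmeticFunction.vonMangoldt n : ℝ) / Real.sqrt n *
      (weilIncrement f (Real.log n) + weilIncrement h (Real.log n) +
        2 * weilIncrement₂ f h (Real.log n)) =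
      (∑ n ∈ weilPrimeIndex c, (ArithmeticFunction.vonMangoldt n : ℝ) / Real.sqrt n *
        weilIncrement f (Real.log n)) +
      (∑ n ∈ weilPrimeIndex c, (ArithmeticFunction.vonMangoldt n : ℝ) / Real.sqrt n *
        weilIncrement h (Real.log n)) +
      2 * ∑ n ∈ weilPrimeIndex c, (ArithmeticFunction.vonMangoldt n : ℝ) / Real.sqrt n *
        weilIncrement₂ f h (Real.log n) := by
    rw [Finset.mul_sum, ← Finset.sum_add_distrib, ← Finset.sum_add_distrib]
    exact Finset.sum_congr rfl fun n _ ↦ by ring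
  rw [es]
  ring

/-- `𝓔_c(a • f) = a² 𝓔_c(f)` for real `a`. -/
theorem dt_weilDirichletEnergy_smul (c a : ℝ) (f : ℝ → ℂ) :
    weilDirichletEnergy c (a • f) = a ^ 2 * weilDirichletEnergy c f := by
  unfold weilDirichletEnergy
  have e : ∀ t, weilArchDensity t * weilIncrement (a • f) t =
      a ^ 2 * (weilArchDensity t * weilIncrement f t) := fun t ↦ by
    rw [dt_weilIncrement_smul]; ring
  simp_rw [e, dt_weilIncrement_smul, integral_const_mul]
  rw [mul_add, Finset.mul_sum]
  congr 1
  exact Finset.sum_congr rfl fun n _ ↦ by ring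

end Summit.RiemannHypothesis.RiemannHypothesis.Theorems.EvenWinsBeyondArch

end
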